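import Literature.NumberTheory.Automorphic.ArchWeightIntegrality
import Literature.NumberTheory.Automorphic.ArchKTypeWeightVector
import HarnessLib

/-!
# `K_∞ = ∏_w O(2) × ∏_w U(2)` is generated by one-parameter subgroups `exp(tX)`, `X ∈ 𝔨`, and the
# signs `δ_w = diag(-1_w, 1)` (Knapp (1986), Ch. I §1)

Topic `NumberTheory/Automorphic`; namespace `Literature.NumberTheory.Automorphic`. Definitions with bodies
(the place embeddings `GL₂(ℝ) → GL₂(K_∞)`, `GL₂(ℂ) → GL₂(K_∞)` and the explicit rotations / phases of
`GL₂(ℝ)`, `GL₂(ℂ)`) and theorems; no named fact, no instance.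

For `K_∞ = mixedSpace K` the maximal compact subgroup `K_∞ = Kinf 2 K = U(2, K_∞)` of `GL₂(K_∞)` is the
product of the `O(2)` at the real places and the `U(2)` at the complex places. We prove
(`Kinf_le_closure`) that it is contained in — hence equal to — the subgroup generated by

* the exponentials `expGL X` of the skew-hermitian `X ∈ M₂(K_∞)` (the image of `𝔨 = 𝔲(2, K_∞)`), and
* the signs `δ_w`, `(δ_w : M₂(K_∞)) = 1 - 2 E₀₀ ⊗ r_w`, at the real places `w`

— concretely every element is a finite product of rotations `exp(t W_w)`, signs `δ_w` (real `w`), and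
`exp(t E₀₀ ⊗ i c_w)`, `exp(t E₁₁ ⊗ i c_w)`, `exp(t (E₀₁ - E₁₀) ⊗ c_w)` (complex `w`): `O(2) = SO(2) ⊔ δ SO(2)`
with `SO(2) = {exp(tW)}`, and the Euler-type factorisation
`u = diag(1, e^{iψ}) R(θ) diag(e^{iα}, e^{iβ})` of `u ∈ U(2)`. This is the device by which statements
proved for one-parameter subgroups (`ArchGardingFiniteDimStable.gardingAct_expGL_mem_of_gardingEnd_mem`:
a finite-dimensional `τ(X)`-stable subspace of the Gårding space is `τ(exp tX)`-stable) are promoted to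
all of `K_∞`.

## References

* A. W. Knapp, *Representation Theory of Semisimple Groups*, Princeton 1986, Ch. I §1 (`SO(2)`, `SU(2)`,
  Euler angles). [Knapp1986]
* H. Jacquet, R. P. Langlands, *Automorphic Forms on GL(2)*, LNM 114 (1970), §5–§6. [JacquetLanglands1970]
-/

noncomputable section

open NumberField NumberField.InfinitePlace NumberField.mixedEmbedding
open scoped MatrixGroups ComplexConjugate Classical

namespace Literature.NumberTheory.Automorphic

variable (K : Type) [Field K] [NumberField K]

-- as in `ArchGardingWhittaker`
set_option backward.isDefEq.respectTransparency false

/-! ### 1. The place embeddings `GL₂(ℝ), GL₂(ℂ) → GL₂(K_∞)` -/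

section Embedding

/-- `a ↦ (a · 1_w, 0)`: the non-unital ring embedding of `ℝ` into `K_∞` at a real place. [folklore] -/
def realPlaceRingHom (w : {w : InfinitePlace K // IsReal w}) : ℝ →ₙ+* mixedSpace K where
  toFun a := (Pi.single w a, 0)
  map_mul' a b := by rw [Prod.mk_mul_mk, Pi.single_mul, mul_zero]
  map_zero' := by rw [Pi.single_zero]; rfl
  map_add' a b := by rw [Prod.mk_add_mk, Pi.single_add, add_zero]

/-- `a ↦ (0, a · 1_w)`: the non-unital ring embedding of `ℂ` into `K_∞` at a complex place. [folklore] -/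
def complexPlaceRingHom (w : {w : InfinitePlace K // IsComplex w}) : ℂ →ₙ+* mixedSpace K where
  toFun a := (0, Pi.single w a)
  map_mul' a b := by rw [Prod.mk_mul_mk, Pi.single_mul, mul_zero]
  map_zero' := by rw [Pi.single_zero]; rfl
  map_add' a b := by rw [Prod.mk_add_mk, Pi.single_add, add_zero]

omit [NumberField K] in
/-- `ι_w(a) = a • r_w`. [folklore] -/
theorem realPlaceRingHom_apply (w : {w : InfinitePlace K // IsReal w}) (a : ℝ) :
    realPlaceRingHom K w a = a • ((Pi.single w 1, 0) : mixedSpace K) := by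
  change ((Pi.single w a, 0) : mixedSpace K) = _
  rw [Prod.smul_mk, smul_zero, ← Pi.single_smul', smul_eq_mul, mul_one]

omit [NumberField K] in
/-- `ι_w(a) = (0, a · 1_w)`. [folklore] -/
theorem complexPlaceRingHom_apply (w : {w : InfinitePlace K // IsComplex w}) (a : ℂ) :
    complexPlaceRingHom K w a = ((0, Pi.single w a) : mixedSpace K) := rfl

omit [NumberField K] in
/-- Evaluation of `ι_w(a)` at a real place. [folklore] -/
theorem evalReal_realPlaceRingHom (v w : {w : InfinitePlace K // IsReal w}) (a : ℝ) :
    mixedSpaceEvalReal K v (realPlaceRingHom K w a) = if v = w then a else 0 := by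
  change (Pi.single w a : {w : InfinitePlace K // IsReal w} → ℝ) v = _
  rw [Pi.single_apply]

omit [NumberField K] in
/-- Evaluation of `ι_w(a)` (real `w`) at a complex place is `0`. [folklore] -/
theorem evalComplex_realPlaceRingHom (v : {w : InfinitePlace K // IsComplex w}) (w : {w : InfinitePlace K // IsReal w}) (a : ℝ) :
    mixedSpaceEvalComplex K v (realPlaceRingHom K w a) = 0 := rfl

omit [NumberField K] in
/-- Evaluation of `ι_w(a)` at a complex place. [folklore] -/
theorem evalComplex_complexPlaceRingHom (v w : {w : InfinitePlace K // IsComplex w}) (a : ℂ) :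
    mixedSpaceEvalComplex K v (complexPlaceRingHom K w a) = if v = w then a else 0 := by
  change (Pi.single w a : {w : InfinitePlace K // IsComplex w} → ℂ) v = _
  rw [Pi.single_apply]

omit [NumberField K] in
/-- Evaluation of `ι_w(a)` (complex `w`) at a real place is `0`. [folklore] -/
theorem evalReal_complexPlaceRingHom (v : {w : InfinitePlace K // IsReal w}) (w : {w : InfinitePlace K // IsComplex w}) (a : ℂ) :
    mixedSpaceEvalReal K v (complexPlaceRingHom K w a) = 0 := rfl

/-- **`A ↦ 1 + ι_w(A - 1)`**: the multiplicative embedding `M₂(ℝ) → M₂(K_∞)` at a real place ("`A` at `w`,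
the identity elsewhere"). [folklore] -/
def realPlaceLift (w : {w : InfinitePlace K // IsReal w}) : Matrix (Fin 2) (Fin 2) ℝ →* Matrix (Fin 2) (Fin 2) (mixedSpace K) where
  toFun A := 1 + NonUnitalRingHom.mapMatrix (Fin 2) (realPlaceRingHom K w) (A - 1)
  map_one' := by rw [sub_self, map_zero, add_zero]
  map_mul' A B := by
    have e : A * B - 1 = (A - 1) + (B - 1) + (A - 1) * (B - 1) := by noncomm_ring
    rw [e, map_add, map_add, map_mul]
    noncomm_ring

/-- The same at a complex place. [folklore] -/
def complexPlaceLift (w : {w : InfinitePlace K // IsComplex w}) : Matrix (Fin 2) (Fin 2) ℂ →* Matrix (Fin 2) (Fin 2) (mixedSpace K) where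
  toFun A := 1 + NonUnitalRingHom.mapMatrix (Fin 2) (complexPlaceRingHom K w) (A - 1)
  map_one' := by rw [sub_self, map_zero, add_zero]
  map_mul' A B := by
    have e : A * B - 1 = (A - 1) + (B - 1) + (A - 1) * (B - 1) := by noncomm_ring
    rw [e, map_add, map_add, map_mul]
    noncomm_ring

omit [NumberField K] in
/-- Unfolding of `realPlaceLift`. [folklore] -/
theorem realPlaceLift_apply (w : {w : InfinitePlace K // IsReal w}) (A : Matrix (Fin 2) (Fin 2) ℝ) :
    realPlaceLift K w A = 1 + NonUnitalRingHom.mapMatrix (Fin 2) (realPlaceRingHom K w) (A - 1) := rfl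

omit [NumberField K] in
/-- Unfolding of `complexPlaceLift`. [folklore] -/
theorem complexPlaceLift_apply (w : {w : InfinitePlace K // IsComplex w}) (A : Matrix (Fin 2) (Fin 2) ℂ) :
    complexPlaceLift K w A = 1 + NonUnitalRingHom.mapMatrix (Fin 2) (complexPlaceRingHom K w) (A - 1) := rfl

/-- **The place embedding `GL₂(ℝ) → GL₂(K_∞)`** at a real place. [folklore] -/
def realPlaceGL (w : {w : InfinitePlace K // IsReal w}) : GL (Fin 2) ℝ →* GL (Fin 2) (mixedSpace K) :=
  Units.map (realPlaceLift K w)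

/-- **The place embedding `GL₂(ℂ) → GL₂(K_∞)`** at a complex place. [folklore] -/
def complexPlaceGL (w : {w : InfinitePlace K // IsComplex w}) : GL (Fin 2) ℂ →* GL (Fin 2) (mixedSpace K) :=
  Units.map (complexPlaceLift K w)

omit [NumberField K] in
/-- The matrix of `realPlaceGL w A`. [folklore] -/
theorem coe_realPlaceGL (w : {w : InfinitePlace K // IsReal w}) (A : GL (Fin 2) ℝ) :
    ((realPlaceGL K w A : GL (Fin 2) (mixedSpace K)) : Matrix (Fin 2) (Fin 2) (mixedSpace K)) =
      1 + NonUnitalRingHom.mapMatrix (Fin 2) (realPlaceRingHom K w) ((A : Matrix (Fin 2) (Fin 2) ℝ) - 1) := rfl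

omit [NumberField K] in
/-- The matrix of `complexPlaceGL w A`. [folklore] -/
theorem coe_complexPlaceGL (w : {w : InfinitePlace K // IsComplex w}) (A : GL (Fin 2) ℂ) :
    ((complexPlaceGL K w A : GL (Fin 2) (mixedSpace K)) : Matrix (Fin 2) (Fin 2) (mixedSpace K)) =
      1 + NonUnitalRingHom.mapMatrix (Fin 2) (complexPlaceRingHom K w) ((A : Matrix (Fin 2) (Fin 2) ℂ) - 1) := rfl

/-! Evaluation of the lifts at the places. -/

omit [NumberField K] in
/-- `realPlaceLift w A` evaluates to `A` at `w` and to `1` at the other real places. [folklore] -/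
theorem evalReal_realPlaceLift (v w : {w : InfinitePlace K // IsReal w}) (A : Matrix (Fin 2) (Fin 2) ℝ) :
    (mixedSpaceEvalReal K v).mapMatrix (realPlaceLift K w A) = if v = w then A else 1 := by
  rw [realPlaceLift_apply, map_add, map_one]
  ext i j
  rw [Matrix.add_apply, RingHom.mapMatrix_apply, Matrix.map_apply, NonUnitalRingHom.mapMatrix_apply, Matrix.map_apply,
    evalReal_realPlaceRingHom]
  split_ifs with h
  · rw [Matrix.sub_apply, add_sub_cancel]
  · rw [add_zero]

omit [NumberField K] in
/-- `realPlaceLift w A` evaluates to `1` at the complex places. [folklore] -/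
theorem evalComplex_realPlaceLift (v : {w : InfinitePlace K // IsComplex w}) (w : {w : InfinitePlace K // IsReal w})
    (A : Matrix (Fin 2) (Fin 2) ℝ) : (mixedSpaceEvalComplex K v).mapMatrix (realPlaceLift K w A) = 1 := by
  rw [realPlaceLift_apply, map_add, map_one]
  ext i j
  rw [Matrix.add_apply, RingHom.mapMatrix_apply, Matrix.map_apply, NonUnitalRingHom.mapMatrix_apply, Matrix.map_apply,
    evalComplex_realPlaceRingHom, add_zero]

omit [NumberField K] in
/-- `complexPlaceLift w A` evaluates to `A` at `w` and to `1` at the other complex places. [folklore] -/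
theorem evalComplex_complexPlaceLift (v w : {w : InfinitePlace K // IsComplex w}) (A : Matrix (Fin 2) (Fin 2) ℂ) :
    (mixedSpaceEvalComplex K v).mapMatrix (complexPlaceLift K w A) = if v = w then A else 1 := by
  rw [complexPlaceLift_apply, map_add, map_one]
  ext i j
  rw [Matrix.add_apply, RingHom.mapMatrix_apply, Matrix.map_apply, NonUnitalRingHom.mapMatrix_apply, Matrix.map_apply,
    evalComplex_complexPlaceRingHom]
  split_ifs with h
  · rw [Matrix.sub_apply, add_sub_cancel]
  · rw [add_zero]

omit [NumberField K] in
/-- `complexPlaceLift w A` evaluates to `1` at the real places. [folklore] -/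
theorem evalReal_complexPlaceLift (v : {w : InfinitePlace K // IsReal w}) (w : {w : InfinitePlace K // IsComplex w})
    (A : Matrix (Fin 2) (Fin 2) ℂ) : (mixedSpaceEvalReal K v).mapMatrix (complexPlaceLift K w A) = 1 := by
  rw [complexPlaceLift_apply, map_add, map_one]
  ext i j
  rw [Matrix.add_apply, RingHom.mapMatrix_apply, Matrix.map_apply, NonUnitalRingHom.mapMatrix_apply, Matrix.map_apply,
    evalReal_complexPlaceRingHom, add_zero]

omit [NumberField K] in
/-- `realPlaceGL w A` evaluates to `A` at `w` and to `1` at the other real places. [folklore] -/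
theorem evalReal_coe_realPlaceGL (v w : {w : InfinitePlace K // IsReal w}) (A : GL (Fin 2) ℝ) :
    (mixedSpaceEvalReal K v).mapMatrix ((realPlaceGL K w A : GL (Fin 2) (mixedSpace K)) : Matrix (Fin 2) (Fin 2) (mixedSpace K)) =
      if v = w then (A : Matrix (Fin 2) (Fin 2) ℝ) else 1 :=
  evalReal_realPlaceLift K v w _

omit [NumberField K] in
/-- `realPlaceGL w A` evaluates to `1` at the complex places. [folklore] -/
theorem evalComplex_coe_realPlaceGL (v : {w : InfinitePlace K // IsComplex w}) (w : {w : InfinitePlace K // IsReal w}) (A : GL (Fin 2) ℝ) :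
    (mixedSpaceEvalComplex K v).mapMatrix ((realPlaceGL K w A : GL (Fin 2) (mixedSpace K)) : Matrix (Fin 2) (Fin 2) (mixedSpace K)) = 1 :=
  evalComplex_realPlaceLift K v w _

omit [NumberField K] in
/-- `complexPlaceGL w A` evaluates to `A` at `w` and to `1` at the other complex places. [folklore] -/
theorem evalComplex_coe_complexPlaceGL (v w : {w : InfinitePlace K // IsComplex w}) (A : GL (Fin 2) ℂ) :
    (mixedSpaceEvalComplex K v).mapMatrix ((complexPlaceGL K w A : GL (Fin 2) (mixedSpace K)) : Matrix (Fin 2) (Fin 2) (mixedSpace K)) =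
      if v = w then (A : Matrix (Fin 2) (Fin 2) ℂ) else 1 :=
  evalComplex_complexPlaceLift K v w _

omit [NumberField K] in
/-- `complexPlaceGL w A` evaluates to `1` at the real places. [folklore] -/
theorem evalReal_coe_complexPlaceGL (v : {w : InfinitePlace K // IsReal w}) (w : {w : InfinitePlace K // IsComplex w}) (A : GL (Fin 2) ℂ) :
    (mixedSpaceEvalReal K v).mapMatrix ((complexPlaceGL K w A : GL (Fin 2) (mixedSpace K)) : Matrix (Fin 2) (Fin 2) (mixedSpace K)) = 1 :=
  evalReal_complexPlaceLift K v w _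

omit [NumberField K] in
/-- A matrix over `K_∞` is determined by its evaluations at the places. [folklore] -/
theorem matrix_ext_of_eval {M N : Matrix (Fin 2) (Fin 2) (mixedSpace K)}
    (hR : ∀ v, (mixedSpaceEvalReal K v).mapMatrix M = (mixedSpaceEvalReal K v).mapMatrix N)
    (hC : ∀ v, (mixedSpaceEvalComplex K v).mapMatrix M = (mixedSpaceEvalComplex K v).mapMatrix N) : M = N := by
  ext i j
  · rename_i v
    have h := congrFun (congrFun (hR v) i) j
    simpa [RingHom.mapMatrix_apply, Matrix.map_apply] using h
  · rename_i v
    have h := congrFun (congrFun (hC v) i) j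
    simpa [RingHom.mapMatrix_apply, Matrix.map_apply] using h

/-- **Place-by-place assembly**: an element `κ ∈ GL₂(K_∞)` lies in a subgroup `H` as soon as all its place
components, re-embedded, do. [folklore] -/
theorem mem_of_placeGL_mem (κ : GL (Fin 2) (mixedSpace K)) (H : Subgroup (GL (Fin 2) (mixedSpace K)))
    (hR : ∀ w, realPlaceGL K w (Matrix.GeneralLinearGroup.map (mixedSpaceEvalReal K w) κ) ∈ H)
    (hC : ∀ w, complexPlaceGL K w (Matrix.GeneralLinearGroup.map (mixedSpaceEvalComplex K w) κ) ∈ H) : κ ∈ H := by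
  classical
  -- real places
  have stepR : ∀ T : Finset {w : InfinitePlace K // IsReal w}, ∃ g ∈ H,
      (∀ v, (mixedSpaceEvalReal K v).mapMatrix (g : Matrix (Fin 2) (Fin 2) (mixedSpace K)) =
        if v ∈ T then (mixedSpaceEvalReal K v).mapMatrix (κ : Matrix (Fin 2) (Fin 2) (mixedSpace K)) else 1) ∧
      (∀ v, (mixedSpaceEvalComplex K v).mapMatrix (g : Matrix (Fin 2) (Fin 2) (mixedSpace K)) = 1) := by
    intro T
    induction T using Finset.induction_on with
    | empty => exact ⟨1, H.one_mem, fun v => by simp, fun v => by simp⟩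
    | @insert w T hw ih =>
      obtain ⟨g, hg, hgR, hgC⟩ := ih
      refine ⟨g * realPlaceGL K w (Matrix.GeneralLinearGroup.map (mixedSpaceEvalReal K w) κ), H.mul_mem hg (hR w),
        fun v => ?_, fun v => ?_⟩
      · rw [Units.val_mul, map_mul, hgR v, evalReal_coe_realPlaceGL]
        by_cases hv : v = w
        · subst hv
          rw [if_neg hw, if_pos rfl, if_pos (Finset.mem_insert_self _ _), one_mul]
          rfl
        · rw [if_neg hv, mul_one]
          by_cases hvT : v ∈ T
          · rw [if_pos hvT, if_pos (Finset.mem_insert_of_mem hvT)]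
          · rw [if_neg hvT, if_neg (by rw [Finset.mem_insert]; push Not; exact ⟨hv, hvT⟩)]
      · rw [Units.val_mul, map_mul, hgC v, evalComplex_coe_realPlaceGL, one_mul]
  obtain ⟨g₀, hg₀, hg₀R, hg₀C⟩ := stepR Finset.univ
  -- complex places
  have stepC : ∀ T : Finset {w : InfinitePlace K // IsComplex w}, ∃ g ∈ H,
      (∀ v, (mixedSpaceEvalReal K v).mapMatrix (g : Matrix (Fin 2) (Fin 2) (mixedSpace K)) =
        (mixedSpaceEvalReal K v).mapMatrix (κ : Matrix (Fin 2) (Fin 2) (mixedSpace K))) ∧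
      (∀ v, (mixedSpaceEvalComplex K v).mapMatrix (g : Matrix (Fin 2) (Fin 2) (mixedSpace K)) =
        if v ∈ T then (mixedSpaceEvalComplex K v).mapMatrix (κ : Matrix (Fin 2) (Fin 2) (mixedSpace K)) else 1) := by
    intro T
    induction T using Finset.induction_on with
    | empty => exact ⟨g₀, hg₀, fun v => by rw [hg₀R v, if_pos (Finset.mem_univ _)], fun v => by rw [hg₀C v]; simp⟩
    | @insert w T hw ih =>
      obtain ⟨g, hg, hgR, hgC⟩ := ih
      refine ⟨g * complexPlaceGL K w (Matrix.GeneralLinearGroup.map (mixedSpaceEvalComplex K w) κ), H.mul_mem hg (hC w),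
        fun v => ?_, fun v => ?_⟩
      · rw [Units.val_mul, map_mul, hgR v, evalReal_coe_complexPlaceGL, mul_one]
      · rw [Units.val_mul, map_mul, hgC v, evalComplex_coe_complexPlaceGL]
        by_cases hv : v = w
        · subst hv
          rw [if_neg hw, if_pos rfl, if_pos (Finset.mem_insert_self _ _), one_mul]
          rfl
        · rw [if_neg hv, mul_one]
          by_cases hvT : v ∈ T
          · rw [if_pos hvT, if_pos (Finset.mem_insert_of_mem hvT)]
          · rw [if_neg hvT, if_neg (by rw [Finset.mem_insert]; push Not; exact ⟨hv, hvT⟩)]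
  obtain ⟨g, hg, hgR, hgC⟩ := stepC Finset.univ
  have hκ : g = κ := Units.ext (matrix_ext_of_eval K hgR fun v => by rw [hgC v, if_pos (Finset.mem_univ _)])
  exact hκ ▸ hg

end Embedding

/-! ### 2. `O(2)` is generated by the rotations and one reflection -/

section RealTwo

/-- The rotation `R(t) = (cos t, sin t; -sin t, cos t) ∈ GL₂(ℝ)` (`= exp t(E₀₁ - E₁₀)`). [folklore] -/
def rotGLR (t : ℝ) : GL (Fin 2) ℝ where
  val := !![Real.cos t, Real.sin t; -Real.sin t, Real.cos t]
  inv := !![Real.cos t, -Real.sin t; Real.sin t, Real.cos t]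
  val_inv := by
    ext i j
    fin_cases i <;> fin_cases j <;> simp [Matrix.mul_apply, Fin.sum_univ_two] <;> nlinarith [Real.sin_sq_add_cos_sq t]
  inv_val := by
    ext i j
    fin_cases i <;> fin_cases j <;> simp [Matrix.mul_apply, Fin.sum_univ_two] <;> nlinarith [Real.sin_sq_add_cos_sq t]

/-- The reflection `diag(-1, 1) ∈ GL₂(ℝ)`. [folklore] -/
def reflGLR : GL (Fin 2) ℝ where
  val := !![-1, 0; 0, 1]
  inv := !![-1, 0; 0, 1]
  val_inv := by ext i j; fin_cases i <;> fin_cases j <;> simp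
  inv_val := by ext i j; fin_cases i <;> fin_cases j <;> simp

/-- The matrix of `R(t)`. [folklore] -/
theorem coe_rotGLR (t : ℝ) : ((rotGLR t : GL (Fin 2) ℝ) : Matrix (Fin 2) (Fin 2) ℝ) = !![Real.cos t, Real.sin t; -Real.sin t, Real.cos t] := rfl

/-- The matrix of the reflection. [folklore] -/
theorem coe_reflGLR : ((reflGLR : GL (Fin 2) ℝ) : Matrix (Fin 2) (Fin 2) ℝ) = !![-1, 0; 0, 1] := rfl

/-- A unit vector of `ℝ²` is `(cos t, sin t)`. [folklore] -/
theorem exists_cos_sin_of_sq_add_sq_eq_one {a b : ℝ} (h : a * a + b * b = 1) : ∃ t : ℝ, Real.cos t = a ∧ Real.sin t = b := by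
  have hn : ‖(⟨a, b⟩ : ℂ)‖ = 1 := by
    rw [Complex.norm_def, Complex.normSq_mk, h, Real.sqrt_one]
  refine ⟨Complex.arg ⟨a, b⟩, ?_, ?_⟩
  · have h1 := Complex.norm_mul_cos_arg (⟨a, b⟩ : ℂ)
    rwa [hn, one_mul] at h1
  · have h1 := Complex.norm_mul_sin_arg (⟨a, b⟩ : ℂ)
    rwa [hn, one_mul] at h1

/-- **`O(2) = ⟨R(t), diag(-1,1)⟩`**: an orthogonal `2 × 2` matrix is a rotation `R(t)` or
`R(π) · diag(-1,1) · R(t)`. [cite: Knapp1986, Ch. I §1] -/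
theorem mem_closure_rot_refl_of_mem_unitary {U : GL (Fin 2) ℝ} (hU : U ∈ unitarySubgroupGL ℝ (Fin 2)) :
    U ∈ Subgroup.closure (Set.range rotGLR ∪ {reflGLR}) := by
  rw [mem_unitarySubgroupGL_iff_coe_mem_unitaryGroup, Matrix.mem_unitaryGroup_iff] at hU
  set a := (U : Matrix (Fin 2) (Fin 2) ℝ) 0 0 with ha
  set b := (U : Matrix (Fin 2) (Fin 2) ℝ) 0 1 with hb
  set c := (U : Matrix (Fin 2) (Fin 2) ℝ) 1 0 with hc
  set d := (U : Matrix (Fin 2) (Fin 2) ℝ) 1 1 with hd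
  have e00 := congrFun (congrFun hU 0) 0
  have e01 := congrFun (congrFun hU 0) 1
  have e11 := congrFun (congrFun hU 1) 1
  simp only [Matrix.mul_apply, Fin.sum_univ_two, Matrix.star_apply, star_trivial, Matrix.one_apply_eq,
    Matrix.one_apply_ne (by decide : (0 : Fin 2) ≠ 1)] at e00 e01 e11
  rw [← ha, ← hb] at e00
  rw [← ha, ← hb, ← hc, ← hd] at e01
  rw [← hc, ← hd] at e11
  -- `(a, b) = (cos t, sin t)` and `(c, d) = ε (-b, a)`, `ε = ad - bc = ±1`
  obtain ⟨t, hta, htb⟩ := exists_cos_sin_of_sq_add_sq_eq_one e00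
  set ε := a * d - b * c with hε
  have hcε : c = -(ε * b) := by
    have : ε * b = -(c * (a * a + b * b)) := by rw [hε]; linear_combination a * e01
    rw [this, e00, mul_one, neg_neg]
  have hdε : d = ε * a := by
    have : ε * a = d * (a * a + b * b) := by rw [hε]; linear_combination (-b) * e01
    rw [this, e00, mul_one]
  have hε2 : ε * ε = 1 := by
    have : ε * ε = (a * a + b * b) * (c * c + d * d) - (a * c + b * d) * (a * c + b * d) := by rw [hε]; ring
    rw [this, e00, e11, e01]; ring
  have hrot : ∀ s, rotGLR s ∈ Subgroup.closure (Set.range rotGLR ∪ {reflGLR}) := fun s =>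
    Subgroup.subset_closure (Or.inl ⟨s, rfl⟩)
  have hrefl : reflGLR ∈ Subgroup.closure (Set.range rotGLR ∪ {reflGLR}) := Subgroup.subset_closure (Or.inr rfl)
  rcases mul_self_eq_one_iff.1 hε2 with h1 | h1
  · -- `U = R(t)`
    have hUeq : U = rotGLR t := by
      refine Units.ext ?_
      ext i j
      fin_cases i <;> fin_cases j
      · exact ha.symm.trans hta.symm
      · exact hb.symm.trans htb.symm
      · change c = -Real.sin t
        rw [hcε, h1, one_mul, htb]
      · change d = Real.cos t
        rw [hdε, h1, one_mul, hta]
    rw [hUeq]; exact hrot t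
  · -- `U = R(π) · diag(-1,1) · R(t)`
    have hUeq : U = rotGLR Real.pi * reflGLR * rotGLR t := by
      refine Units.ext ?_
      rw [Units.val_mul, Units.val_mul, coe_rotGLR, coe_rotGLR, coe_reflGLR, Real.cos_pi, Real.sin_pi]
      ext i j
      fin_cases i <;> fin_cases j
      · change a = _
        simp [Matrix.mul_apply, Fin.sum_univ_two, hta]
      · change b = _
        simp [Matrix.mul_apply, Fin.sum_univ_two, htb]
      · change c = _
        simp [Matrix.mul_apply, Fin.sum_univ_two]
        rw [hcε, h1, htb]; ring
      · change d = _
        simp [Matrix.mul_apply, Fin.sum_univ_two]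
        rw [hdε, h1, hta]; ring
    rw [hUeq]
    exact Subgroup.mul_mem _ (Subgroup.mul_mem _ (hrot _) hrefl) (hrot t)

end RealTwo

/-! ### 3. `U(2)` is generated by the phases `diag(e^{it}, 1)`, `diag(1, e^{it})` and the rotations -/

section ComplexTwo

/-- The rotation `R(t) = (cos t, sin t; -sin t, cos t) ∈ GL₂(ℂ)`. [folklore] -/
def rotGLC (t : ℝ) : GL (Fin 2) ℂ where
  val := !![(Real.cos t : ℂ), (Real.sin t : ℂ); -(Real.sin t : ℂ), (Real.cos t : ℂ)]
  inv := !![(Real.cos t : ℂ), -(Real.sin t : ℂ); (Real.sin t : ℂ), (Real.cos t : ℂ)]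
  val_inv := by
    have h : Complex.cos t * Complex.cos t + Complex.sin t * Complex.sin t = 1 := by
      linear_combination Complex.cos_sq_add_sin_sq (t : ℂ)
    ext i j
    fin_cases i <;> fin_cases j <;> simp [Matrix.mul_apply, Fin.sum_univ_two] <;> first | linear_combination h | ring
  inv_val := by
    have h : Complex.cos t * Complex.cos t + Complex.sin t * Complex.sin t = 1 := by
      linear_combination Complex.cos_sq_add_sin_sq (t : ℂ)
    ext i j
    fin_cases i <;> fin_cases j <;> simp [Matrix.mul_apply, Fin.sum_univ_two] <;> first | linear_combination h | ring

/-- The phase `diag(e^{it}, 1) ∈ GL₂(ℂ)`. [folklore] -/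
def phase0GLC (t : ℝ) : GL (Fin 2) ℂ where
  val := !![Complex.exp (t * Complex.I), 0; 0, 1]
  inv := !![Complex.exp (-(t * Complex.I)), 0; 0, 1]
  val_inv := by
    ext i j
    fin_cases i <;> fin_cases j <;> simp [Matrix.mul_apply, Fin.sum_univ_two, ← Complex.exp_add]
  inv_val := by
    ext i j
    fin_cases i <;> fin_cases j <;> simp [Matrix.mul_apply, Fin.sum_univ_two, ← Complex.exp_add]

/-- The phase `diag(1, e^{it}) ∈ GL₂(ℂ)`. [folklore] -/
def phase1GLC (t : ℝ) : GL (Fin 2) ℂ where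
  val := !![1, 0; 0, Complex.exp (t * Complex.I)]
  inv := !![1, 0; 0, Complex.exp (-(t * Complex.I))]
  val_inv := by
    ext i j
    fin_cases i <;> fin_cases j <;> simp [Matrix.mul_apply, Fin.sum_univ_two, ← Complex.exp_add]
  inv_val := by
    ext i j
    fin_cases i <;> fin_cases j <;> simp [Matrix.mul_apply, Fin.sum_univ_two, ← Complex.exp_add]

/-- The matrix of `R(t)` over `ℂ`. [folklore] -/
theorem coe_rotGLC (t : ℝ) : ((rotGLC t : GL (Fin 2) ℂ) : Matrix (Fin 2) (Fin 2) ℂ) =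
    !![(Real.cos t : ℂ), (Real.sin t : ℂ); -(Real.sin t : ℂ), (Real.cos t : ℂ)] := rfl
/-- The matrix of `diag(e^{it}, 1)`. [folklore] -/
theorem coe_phase0GLC (t : ℝ) : ((phase0GLC t : GL (Fin 2) ℂ) : Matrix (Fin 2) (Fin 2) ℂ) = !![Complex.exp (t * Complex.I), 0; 0, 1] := rfl
/-- The matrix of `diag(1, e^{it})`. [folklore] -/
theorem coe_phase1GLC (t : ℝ) : ((phase1GLC t : GL (Fin 2) ℂ) : Matrix (Fin 2) (Fin 2) ℂ) = !![1, 0; 0, Complex.exp (t * Complex.I)] := rfl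

/-- `z = ‖z‖ e^{i arg z}` and `e^{iθ} conj(e^{iθ}) = 1`. [folklore] -/
theorem exp_arg_facts (z : ℂ) : (‖z‖ : ℂ) * Complex.exp (Complex.arg z * Complex.I) = z ∧
    Complex.exp (Complex.arg z * Complex.I) * conj (Complex.exp (Complex.arg z * Complex.I)) = 1 := by
  refine ⟨Complex.norm_mul_exp_arg_mul_I z, ?_⟩
  rw [Complex.mul_conj, Complex.normSq_eq_norm_sq, Complex.norm_exp_ofReal_mul_I]
  simp

/-- **`U(2) = ⟨diag(e^{it},1), diag(1,e^{it}), R(t)⟩`**: a unitary `2 × 2` matrix is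
`diag(1, e^{iψ}) R(θ) diag(e^{iα}, 1) diag(1, e^{iβ})` (Euler-type factorisation: the first row is
`(cos θ e^{iα}, sin θ e^{iβ})`, the second a phase times the orthogonal unit vector).
[cite: Knapp1986, Ch. I §1] -/
theorem mem_closure_phase_rot_of_mem_unitary {U : GL (Fin 2) ℂ} (hU : U ∈ unitarySubgroupGL ℂ (Fin 2)) :
    U ∈ Subgroup.closure (Set.range phase0GLC ∪ Set.range phase1GLC ∪ Set.range rotGLC) := by
  rw [mem_unitarySubgroupGL_iff_coe_mem_unitaryGroup, Matrix.mem_unitaryGroup_iff] at hU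
  set a := (U : Matrix (Fin 2) (Fin 2) ℂ) 0 0 with ha
  set b := (U : Matrix (Fin 2) (Fin 2) ℂ) 0 1 with hb
  set c := (U : Matrix (Fin 2) (Fin 2) ℂ) 1 0 with hc
  set d := (U : Matrix (Fin 2) (Fin 2) ℂ) 1 1 with hd
  have e00 := congrFun (congrFun hU 0) 0
  have e10 := congrFun (congrFun hU 1) 0
  have e11 := congrFun (congrFun hU 1) 1
  simp only [Matrix.mul_apply, Fin.sum_univ_two, Matrix.star_apply, Matrix.one_apply_eq,
    Matrix.one_apply_ne (by decide : (1 : Fin 2) ≠ 0)] at e00 e10 e11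
  rw [← ha, ← hb] at e00
  rw [← ha, ← hb, ← hc, ← hd] at e10
  rw [← hc, ← hd] at e11
  -- polar forms `a = ‖a‖ e^{iα}`, `b = ‖b‖ e^{iβ}`, `(‖a‖, ‖b‖) = (cos θ, sin θ)`
  obtain ⟨hpa, hua⟩ := exp_arg_facts a
  obtain ⟨hpb, hub⟩ := exp_arg_facts b
  set eα := Complex.exp (Complex.arg a * Complex.I) with heα
  set eβ := Complex.exp (Complex.arg b * Complex.I) with heβ
  have hnorm : ‖a‖ * ‖a‖ + ‖b‖ * ‖b‖ = 1 := by
    have h1 : (a * star a + b * star b).re = 1 := by rw [e00]; simp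
    simpa [Complex.star_def, Complex.mul_conj, Complex.normSq_eq_norm_sq, sq] using h1
  obtain ⟨θ, hθa, hθb⟩ := exists_cos_sin_of_sq_add_sq_eq_one hnorm
  -- the orthonormal frame `m₀ = (a, b)`, `m₁ = (-sin θ e^{iα}, cos θ e^{iβ})` and `λ = ⟨(c,d), m₁⟩`
  set lam := c * conj (-(Real.sin θ : ℂ) * eα) + d * conj ((Real.cos θ : ℂ) * eβ) with hlam
  have hcs : (Real.cos θ : ℂ) * Real.cos θ + Real.sin θ * Real.sin θ = 1 := by
    have := Real.cos_sq_add_sin_sq θ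
    exact_mod_cast (by nlinarith [this] : Real.cos θ * Real.cos θ + Real.sin θ * Real.sin θ = 1)
  have ha' : a = Real.cos θ * eα := by rw [hθa]; exact hpa.symm
  have hb' : b = Real.sin θ * eβ := by rw [hθb]; exact hpb.symm
  have horth : c * conj a + d * conj b = 0 := by
    simpa [Complex.star_def] using e10
  -- expansion of `(c, d)` in the frame: the `m₀`-component vanishes
  have hc' : c = lam * (-(Real.sin θ : ℂ) * eα) := by
    have key : c = (c * conj a + d * conj b) * a + lam * (-(Real.sin θ : ℂ) * eα) := by
      rw [hlam, ha', hb']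
      simp only [map_mul, map_neg, Complex.conj_ofReal]
      linear_combination (-(c * ((Real.cos θ : ℂ) * Real.cos θ + Real.sin θ * Real.sin θ))) * hua + (-c) * hcs
    rw [horth, zero_mul, zero_add] at key
    exact key
  have hd' : d = lam * ((Real.cos θ : ℂ) * eβ) := by
    have key : d = (c * conj a + d * conj b) * b + lam * ((Real.cos θ : ℂ) * eβ) := by
      rw [hlam, ha', hb']
      simp only [map_mul, map_neg, Complex.conj_ofReal]
      linear_combination (-(d * ((Real.cos θ : ℂ) * Real.cos θ + Real.sin θ * Real.sin θ))) * hub + (-d) * hcs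
    rw [horth, zero_mul, zero_add] at key
    exact key
  -- `|λ| = 1`, `λ = e^{iψ}`
  have hlam1 : lam * conj lam = 1 := by
    have h := e11
    rw [hc', hd'] at h
    simp only [Complex.star_def, map_mul, map_neg, Complex.conj_ofReal] at h
    -- h : λ m₁₀ conj(λ m₁₀) + λ m₁₁ conj(λ m₁₁) = 1
    have : lam * conj lam = lam * conj lam * ((Real.cos θ : ℂ) * Real.cos θ + Real.sin θ * Real.sin θ) := by rw [hcs, mul_one]
    rw [this]
    linear_combination h + (-(lam * conj lam * ↑(Real.sin θ) * ↑(Real.sin θ))) * hua +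
      (-(lam * conj lam * ↑(Real.cos θ) * ↑(Real.cos θ))) * hub
  have hlamn : ‖lam‖ = 1 := by
    have h := hlam1
    rw [Complex.mul_conj, Complex.normSq_eq_norm_sq] at h
    have h2 : ‖lam‖ ^ 2 = 1 := by exact_mod_cast h
    exact (pow_eq_one_iff_of_nonneg (norm_nonneg lam) two_ne_zero).1 h2
  obtain ⟨hplam, -⟩ := exp_arg_facts lam
  rw [hlamn, Complex.ofReal_one, one_mul] at hplam
  -- the factorisation
  have hgen0 : ∀ s, phase0GLC s ∈ Subgroup.closure (Set.range phase0GLC ∪ Set.range phase1GLC ∪ Set.range rotGLC) := fun s =>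
    Subgroup.subset_closure (Or.inl (Or.inl ⟨s, rfl⟩))
  have hgen1 : ∀ s, phase1GLC s ∈ Subgroup.closure (Set.range phase0GLC ∪ Set.range phase1GLC ∪ Set.range rotGLC) := fun s =>
    Subgroup.subset_closure (Or.inl (Or.inr ⟨s, rfl⟩))
  have hgenr : ∀ s, rotGLC s ∈ Subgroup.closure (Set.range phase0GLC ∪ Set.range phase1GLC ∪ Set.range rotGLC) := fun s =>
    Subgroup.subset_closure (Or.inr ⟨s, rfl⟩)
  have hUeq : U = phase1GLC (Complex.arg lam) * rotGLC θ * phase0GLC (Complex.arg a) * phase1GLC (Complex.arg b) := by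
    refine Units.ext ?_
    rw [Units.val_mul, Units.val_mul, Units.val_mul, coe_phase1GLC, coe_rotGLC, coe_phase0GLC, coe_phase1GLC, ← heα, ← heβ, hplam]
    ext i j
    fin_cases i <;> fin_cases j
    · change a = _
      simp [Matrix.mul_apply, Fin.sum_univ_two]
      rw [ha']; push_cast; ring
    · change b = _
      simp [Matrix.mul_apply, Fin.sum_univ_two]
      rw [hb']; push_cast; ring
    · change c = _
      simp [Matrix.mul_apply, Fin.sum_univ_two]
      rw [hc']; push_cast; ring
    · change d = _
      simp [Matrix.mul_apply, Fin.sum_univ_two]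
      rw [hd']; push_cast; ring
  rw [hUeq]
  exact Subgroup.mul_mem _ (Subgroup.mul_mem _ (Subgroup.mul_mem _ (hgen1 _) (hgenr _)) (hgen0 _)) (hgen1 _)

end ComplexTwo

/-! ### 4. The lifted generators are exponentials of skew-hermitian letters, and the signs `δ_w` -/

section Identify

open scoped Matrix.Norms.Operator

local notation "r[" w "]" => ((Pi.single w 1, 0) : mixedSpace K)
local notation "c[" w "]" => ((0, Pi.single w 1) : mixedSpace K)
local notation "cI[" w "]" => ((0, Pi.single w Complex.I) : mixedSpace K)

omit [NumberField K] in
/-- Entries of `ι_w(M)`: `M i j • r_w`. [folklore] -/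
theorem realPlaceRingHom_mapMatrix_apply (w : {w : InfinitePlace K // IsReal w}) (M : Matrix (Fin 2) (Fin 2) ℝ) (i j : Fin 2) :
    NonUnitalRingHom.mapMatrix (Fin 2) (realPlaceRingHom K w) M i j = M i j • r[w] := by
  rw [NonUnitalRingHom.mapMatrix_apply, Matrix.map_apply, realPlaceRingHom_apply]

omit [NumberField K] in
/-- Entries of `ι_w(M)` at a complex place. [folklore] -/
theorem complexPlaceRingHom_mapMatrix_apply (w : {w : InfinitePlace K // IsComplex w}) (M : Matrix (Fin 2) (Fin 2) ℂ) (i j : Fin 2) :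
    NonUnitalRingHom.mapMatrix (Fin 2) (complexPlaceRingHom K w) M i j = ((0, Pi.single w (M i j)) : mixedSpace K) := by
  rw [NonUnitalRingHom.mapMatrix_apply, Matrix.map_apply, complexPlaceRingHom_apply]

omit [NumberField K] in
/-- `(0, z · 1_w) = re z • c_w + im z • (i c_w)`. [folklore] -/
theorem inr_single_eq (w : {w : InfinitePlace K // IsComplex w}) (z : ℂ) :
    ((0, Pi.single w z) : mixedSpace K) = (z.re : ℝ) • c[w] + (z.im : ℝ) • cI[w] := by
  refine Prod.ext (by simp) ?_
  change (Pi.single w z : {w : InfinitePlace K // IsComplex w} → ℂ) =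
    (z.re : ℝ) • (Pi.single w (1 : ℂ) : {w : InfinitePlace K // IsComplex w} → ℂ) + (z.im : ℝ) • (Pi.single w Complex.I : {w : InfinitePlace K // IsComplex w} → ℂ)
  rw [← Pi.single_smul', ← Pi.single_smul', ← Pi.single_add]
  congr 1
  rw [Complex.real_smul, Complex.real_smul, mul_one]
  exact (Complex.re_add_im z).symm

/-- **`ι_w(R(t)) = exp(t W_w)`** at a real place. [folklore] -/
theorem realPlaceGL_rotGLR (w : {w : InfinitePlace K // IsReal w}) (t : ℝ) :
    realPlaceGL K w (rotGLR t) = expGL (t • (Matrix.single (0 : Fin 2) (1 : Fin 2) r[w] - Matrix.single 1 0 r[w])) := by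
  refine Units.ext ?_
  rw [coe_expGL, exp_smul_eq_of_sq_eq_neg (weylR_sq w).1 (weylR_sq w).2 t, coe_realPlaceGL, coe_rotGLR, add_assoc]
  congr 1
  refine Matrix.ext fun i j => ?_
  rw [realPlaceRingHom_mapMatrix_apply, Matrix.add_apply, Matrix.smul_apply, Matrix.smul_apply, Matrix.add_apply,
    Matrix.sub_apply, Matrix.sub_apply]
  fin_cases i <;> fin_cases j <;> simp [sub_smul]

omit [NumberField K] in
/-- **`ι_w(diag(-1,1)) = δ_w`**, `(δ_w) = 1 - 2 E₀₀ ⊗ r_w`, at a real place. [folklore] -/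
theorem coe_realPlaceGL_reflGLR (w : {w : InfinitePlace K // IsReal w}) :
    ((realPlaceGL K w reflGLR : GL (Fin 2) (mixedSpace K)) : Matrix (Fin 2) (Fin 2) (mixedSpace K)) =
      1 - (2 : ℝ) • Matrix.single (0 : Fin 2) (0 : Fin 2) r[w] := by
  have h : NonUnitalRingHom.mapMatrix (Fin 2) (realPlaceRingHom K w) (((reflGLR : GL (Fin 2) ℝ) : Matrix (Fin 2) (Fin 2) ℝ) - 1) =
      -((2 : ℝ) • Matrix.single (0 : Fin 2) (0 : Fin 2) r[w]) := by
    refine Matrix.ext fun i j => ?_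
    rw [realPlaceRingHom_mapMatrix_apply, coe_reflGLR, Matrix.neg_apply, Matrix.smul_apply, Matrix.sub_apply]
    fin_cases i <;> fin_cases j <;> simp
    · rw [← neg_smul]; norm_num
  rw [coe_realPlaceGL, h, sub_eq_add_neg]

omit [NumberField K] in
/-- `J² = -P`, `PJ = J` for the rotation generator `(E₀₁ - E₁₀) ⊗ c_w` and for the corners `E₀₀ ⊗ i c_w`,
`E₁₁ ⊗ i c_w` at a complex place. [folklore] -/
theorem complex_generators_sq (w : {w : InfinitePlace K // IsComplex w}) :
    ((Matrix.single (0 : Fin 2) (1 : Fin 2) c[w] - Matrix.single 1 0 c[w]) * (Matrix.single (0 : Fin 2) (1 : Fin 2) c[w] - Matrix.single 1 0 c[w]) =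
        -(Matrix.single (0 : Fin 2) (0 : Fin 2) c[w] + Matrix.single 1 1 c[w]) ∧
      (Matrix.single (0 : Fin 2) (0 : Fin 2) c[w] + Matrix.single 1 1 c[w]) * (Matrix.single (0 : Fin 2) (1 : Fin 2) c[w] - Matrix.single 1 0 c[w]) =
        Matrix.single (0 : Fin 2) (1 : Fin 2) c[w] - Matrix.single 1 0 c[w]) ∧
    (Matrix.single (1 : Fin 2) (1 : Fin 2) cI[w] * Matrix.single (1 : Fin 2) (1 : Fin 2) cI[w] = -Matrix.single (1 : Fin 2) (1 : Fin 2) c[w] ∧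
      Matrix.single (1 : Fin 2) (1 : Fin 2) c[w] * Matrix.single (1 : Fin 2) (1 : Fin 2) cI[w] = Matrix.single (1 : Fin 2) (1 : Fin 2) cI[w]) := by
  have hcc : c[w] * c[w] = c[w] := complexIdem_mul_self (K := K) w
  have hii := complexIdemI_mul_self (K := K) w
  have hci := complexIdem_mul_complexIdemI (K := K) w
  have hA : ∀ (x y : mixedSpace K) (i : Fin 2), Matrix.single i 0 x * Matrix.single 1 (0 : Fin 2) y = 0 :=
    fun x y i => Matrix.single_mul_single_of_ne (h := by decide) (c := x) i 0 1 y
  have hD : ∀ (x y : mixedSpace K) (i : Fin 2), Matrix.single i 1 x * Matrix.single 0 (1 : Fin 2) y = 0 :=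
    fun x y i => Matrix.single_mul_single_of_ne (h := by decide) (c := x) i 1 0 y
  refine ⟨⟨?_, ?_⟩, ?_, ?_⟩
  · simp only [mul_sub, sub_mul, Matrix.single_mul_single_same, hA, hD, hcc, neg_add]
    abel
  · simp only [add_mul, mul_sub, Matrix.single_mul_single_same, hA, hD, hcc]
    abel
  · rw [Matrix.single_mul_single_same, hii, Matrix.single_neg]
  · rw [Matrix.single_mul_single_same, hci]

/-- **`ι_w(R(t)) = exp(t (E₀₁ - E₁₀) ⊗ c_w)`** at a complex place. [folklore] -/
theorem complexPlaceGL_rotGLC (w : {w : InfinitePlace K // IsComplex w}) (t : ℝ) :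
    complexPlaceGL K w (rotGLC t) = expGL (t • (Matrix.single (0 : Fin 2) (1 : Fin 2) c[w] - Matrix.single 1 0 c[w])) := by
  refine Units.ext ?_
  rw [coe_expGL, exp_smul_eq_of_sq_eq_neg (complex_generators_sq K w).1.1 (complex_generators_sq K w).1.2 t, coe_complexPlaceGL,
    coe_rotGLC, add_assoc]
  congr 1
  refine Matrix.ext fun i j => ?_
  rw [complexPlaceRingHom_mapMatrix_apply, inr_single_eq, Matrix.add_apply, Matrix.smul_apply, Matrix.smul_apply, Matrix.add_apply,
    Matrix.sub_apply, Matrix.sub_apply]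
  fin_cases i <;> fin_cases j <;> simp [sub_smul, -Complex.ofReal_cos, -Complex.ofReal_sin]

/-- **`ι_w(diag(e^{it}, 1)) = exp(t E₀₀ ⊗ i c_w)`** at a complex place. [folklore] -/
theorem complexPlaceGL_phase0GLC (w : {w : InfinitePlace K // IsComplex w}) (t : ℝ) :
    complexPlaceGL K w (phase0GLC t) = expGL (t • Matrix.single (0 : Fin 2) (0 : Fin 2) cI[w]) := by
  refine Units.ext ?_
  rw [coe_expGL, exp_smul_eq_of_sq_eq_neg (torusC_sq w).2.1.1 (torusC_sq w).2.1.2 t, coe_complexPlaceGL, coe_phase0GLC, add_assoc]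
  congr 1
  refine Matrix.ext fun i j => ?_
  rw [complexPlaceRingHom_mapMatrix_apply, inr_single_eq, Matrix.add_apply, Matrix.smul_apply, Matrix.smul_apply, Matrix.sub_apply]
  fin_cases i <;> fin_cases j <;> simp [sub_smul, Complex.exp_ofReal_mul_I_re, Complex.exp_ofReal_mul_I_im]

/-- **`ι_w(diag(1, e^{it})) = exp(t E₁₁ ⊗ i c_w)`** at a complex place. [folklore] -/
theorem complexPlaceGL_phase1GLC (w : {w : InfinitePlace K // IsComplex w}) (t : ℝ) :
    complexPlaceGL K w (phase1GLC t) = expGL (t • Matrix.single (1 : Fin 2) (1 : Fin 2) cI[w]) := by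
  refine Units.ext ?_
  rw [coe_expGL, exp_smul_eq_of_sq_eq_neg (complex_generators_sq K w).2.1 (complex_generators_sq K w).2.2 t, coe_complexPlaceGL,
    coe_phase1GLC, add_assoc]
  congr 1
  refine Matrix.ext fun i j => ?_
  rw [complexPlaceRingHom_mapMatrix_apply, inr_single_eq, Matrix.add_apply, Matrix.smul_apply, Matrix.smul_apply, Matrix.sub_apply]
  fin_cases i <;> fin_cases j <;> simp [sub_smul, Complex.exp_ofReal_mul_I_re, Complex.exp_ofReal_mul_I_im]

omit [NumberField K] in
/-- The corners `E₀₀ ⊗ i c_w`, `E₁₁ ⊗ i c_w` are skew-hermitian. [folklore] -/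
theorem star_single_complexIdemI (w : {w : InfinitePlace K // IsComplex w}) (i : Fin 2) :
    star (Matrix.single i i cI[w]) = -Matrix.single i i cI[w] := by
  rw [Matrix.star_eq_conjTranspose, Matrix.conjTranspose_single, star_complexIdemI, Matrix.single_neg]

end Identify

/-! ### 5. `K_∞` is generated by the `exp X`, `X` skew-hermitian, and the signs `δ_w` -/

section Generators

/-- **`K_∞ ≤ ⟨exp(𝔨), δ_w⟩`.** Every element of the maximal compact subgroup `K_∞ = U(2, K_∞)` of `GL₂(K_∞)` is
a finite product of exponentials `exp X` of skew-hermitian `X ∈ M₂(K_∞)` and signs `δ_w = diag(-1_w, 1)` at the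
real places (and their inverses). [cite: Knapp1986, Ch. I §1] -/
theorem Kinf_le_closure :
    Kinf 2 K ≤ Subgroup.closure ({g | ∃ X : Matrix (Fin 2) (Fin 2) (mixedSpace K), star X = -X ∧ g = expGL X} ∪
      {g | ∃ w : {w : InfinitePlace K // IsReal w}, (g : Matrix (Fin 2) (Fin 2) (mixedSpace K)) =
        1 - (2 : ℝ) • Matrix.single (0 : Fin 2) (0 : Fin 2) ((Pi.single w 1, 0) : mixedSpace K)}) := by
  intro κ hκ
  rw [mem_Kinf_iff] at hκ
  refine mem_of_placeGL_mem K κ _ (fun w => ?_) (fun w => ?_)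
  · have h := Subgroup.mem_map_of_mem (realPlaceGL K w) (mem_closure_rot_refl_of_mem_unitary (hκ.1 w))
    rw [MonoidHom.map_closure] at h
    refine Subgroup.closure_mono ?_ h
    rintro _ ⟨g, hg, rfl⟩
    rcases hg with ⟨t, rfl⟩ | hg
    · refine Or.inl ⟨t • (Matrix.single (0 : Fin 2) (1 : Fin 2) ((Pi.single w 1, 0) : mixedSpace K) - Matrix.single 1 0 ((Pi.single w 1, 0) : mixedSpace K)), ?_,
        realPlaceGL_rotGLR K w t⟩
      rw [star_smul, star_letters.1 w, smul_neg, star_trivial]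
    · rw [Set.mem_singleton_iff] at hg
      subst hg
      exact Or.inr ⟨w, coe_realPlaceGL_reflGLR K w⟩
  · have h := Subgroup.mem_map_of_mem (complexPlaceGL K w) (mem_closure_phase_rot_of_mem_unitary (hκ.2 w))
    rw [MonoidHom.map_closure] at h
    refine Subgroup.closure_mono ?_ h
    rintro _ ⟨g, hg, rfl⟩
    rcases hg with (⟨t, rfl⟩ | ⟨t, rfl⟩) | ⟨t, rfl⟩
    · refine Or.inl ⟨t • Matrix.single (0 : Fin 2) (0 : Fin 2) ((0, Pi.single w Complex.I) : mixedSpace K), ?_, complexPlaceGL_phase0GLC K w t⟩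
      rw [star_smul, star_single_complexIdemI, smul_neg, star_trivial]
    · refine Or.inl ⟨t • Matrix.single (1 : Fin 2) (1 : Fin 2) ((0, Pi.single w Complex.I) : mixedSpace K), ?_, complexPlaceGL_phase1GLC K w t⟩
      rw [star_smul, star_single_complexIdemI, smul_neg, star_trivial]
    · refine Or.inl ⟨t • (Matrix.single (0 : Fin 2) (1 : Fin 2) ((0, Pi.single w 1) : mixedSpace K) - Matrix.single 1 0 ((0, Pi.single w 1) : mixedSpace K)), ?_,
        complexPlaceGL_rotGLC K w t⟩
      rw [star_smul, star_letters.2.2.1 w, smul_neg, star_trivial]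

/-- **Induction principle for `K_∞`**: a property of elements of `GL₂(K_∞)` stable under products and holding
for `1`, for `exp X` (`X` skew-hermitian) and for the signs `δ_w` holds on `K_∞` (inverses come for free:
`(exp X)⁻¹ = exp(-X)`, `δ_w⁻¹ = δ_w`). [folklore] -/
theorem Kinf_induction {P : GL (Fin 2) (mixedSpace K) → Prop} (h1 : P 1) (hmul : ∀ g h, P g → P h → P (g * h))
    (hexp : ∀ X : Matrix (Fin 2) (Fin 2) (mixedSpace K), star X = -X → P (expGL X))
    (hsign : ∀ (w : {w : InfinitePlace K // IsReal w}) (δ : GL (Fin 2) (mixedSpace K)),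
      (δ : Matrix (Fin 2) (Fin 2) (mixedSpace K)) = 1 - (2 : ℝ) • Matrix.single (0 : Fin 2) (0 : Fin 2) ((Pi.single w 1, 0) : mixedSpace K) → P δ)
    {κ : GL (Fin 2) (mixedSpace K)} (hκ : κ ∈ Kinf 2 K) : P κ := by
  have hgen : ∀ g ∈ ({g | ∃ X : Matrix (Fin 2) (Fin 2) (mixedSpace K), star X = -X ∧ g = expGL X} ∪
      {g | ∃ w : {w : InfinitePlace K // IsReal w}, (g : Matrix (Fin 2) (Fin 2) (mixedSpace K)) =
        1 - (2 : ℝ) • Matrix.single (0 : Fin 2) (0 : Fin 2) ((Pi.single w 1, 0) : mixedSpace K)}), P g ∧ P g⁻¹ := by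
    rintro g (⟨X, hX, rfl⟩ | ⟨w, hw⟩)
    · refine ⟨hexp X hX, ?_⟩
      rw [← expGL_neg]
      exact hexp (-X) (by rw [star_neg, hX, neg_neg])
    · refine ⟨hsign w g hw, ?_⟩
      have hH : Matrix.single (0 : Fin 2) (0 : Fin 2) ((Pi.single w 1, 0) : mixedSpace K) * Matrix.single (0 : Fin 2) (0 : Fin 2) ((Pi.single w 1, 0) : mixedSpace K) =
          Matrix.single (0 : Fin 2) (0 : Fin 2) ((Pi.single w 1, 0) : mixedSpace K) := by
        rw [Matrix.single_mul_single_same, realIdem_mul_self]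
      have hinv : g⁻¹ = g := by
        rw [eq_comm, ← mul_eq_one_iff_eq_inv]
        refine Units.ext ?_
        rw [Units.val_mul, hw, Units.val_one, sub_mul, one_mul, smul_mul_assoc, mul_sub, mul_one, mul_smul_comm, hH]
        module
      rw [hinv]
      exact hsign w g hw
  refine Subgroup.closure_induction'' (p := fun g _ => P g) (fun g hg => (hgen g hg).1) (fun g hg => (hgen g hg).2) h1
    (fun g h _ _ hg hh => hmul g h hg hh) (Kinf_le_closure K hκ)

end Generators

end Literature.NumberTheory.Automorphic
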